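import Summits.QuantumFields.YangMills.Theorems.ParabolicTrajectoryContinuumLimitOnTrajectoryReduction
import Summits.QuantumFields.YangMills.Theorems.ParabolicTrajectoryContinuumLimitOnTrajectoryDefsE
import Summits.QuantumFields.YangMills.Theorems.ConvexGribovBodyContinuumLegGivenGapStubUclOfCscl
import Summits.QuantumFields.YangMills.Theorems.ConvexGribovBodyContinuumLegGivenGapStubAsympCS
import Summits.QuantumFields.YangMills.Theorems.ConvexGribovBodyContinuumLegGivenGapStubSmallRotation
import Summits.QuantumFields.YangMills.Theorems.ConvexGribovBodyContinuumLegGivenGapStubBddSlabDensity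
import Summits.QuantumFields.YangMills.Theorems.ConvexGribovBodyContinuumLegGivenGapStubRotOfPythagorean
import Summits.QuantumFields.YangMills.Theorems.ConvexGribovBodyContinuumLegGivenGapStubRotNiven
import Summits.QuantumFields.YangMills.Theorems.ConvexGribovBodyContinuumLegGivenGapStubRotHyper

/-!
# Route `ParabolicTrajectory`, crux `ContinuumLimitOnTrajectory` (stmt-QuantumFields-10522): the reduction of line `two-orbit-synchronisation`, v3.5 — Cauchy–Schwarz clustering currency and discrete rotation restoration

Helper file of the line lead (seat c3, `prover-line-stmt-QuantumFields-10522-c3-0`); sequel of `…Reduction` (v3.4).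
Two cross-crux findings of the lead of stmt-QuantumFields-15828 (`ContinuumLegGivenGap`, evidence on this item of
2026-08-16T22:38Z and 2026-08-17T00:01Z) are consumed here:
* the slack-free torus OS gap `TorusOSGap` in v3.4's IR input `IRPhysics` is UNSATISFIABLE on periodic tori (OS-null
  two-slice witness), so v3.5 re-sources the E4 input `UCL` from the ε-slack Cauchy–Schwarz clustering of the canonical
  scheme, `SpeciesScheme.HasCSClustering r (canon r sch) Δ₁` (Literature `ClustersCS`), via the landed sibling theorem
  `ContinuumLegGivenGap.stub_uclOfCscl` (p132690) and its three landed glue statements `stub_asympCS` (p130870),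
  `stub_smallRotation` (p131039), `stub_bddSlabDensity` (p131325);
* rotation restoration `AsympRot` (all of `SO(4)`) follows from `UUVB` and asymptotic invariance under ONE Pythagorean
  rotation (`Rot345`), via the landed `ContinuumLegGivenGap.stub_rotOfPythagorean` (p133709) with `stub_rotNiven`
  (p133202), `stub_rotHyper` (p133520) — which in turn use this line\'s landed `stub_axisSymmetry`.
Content:
* `Reduction.reductionCS` — `TwoOrbitSync → ChartExists → Anatomy → VolumeClause → IRPhysicsCS → UVPhysics345 → ARPOfRP →
  TranslOfUUVB → OneFieldOSLegs' → ContinuumLimitWithGap`: the v3.4 composition (`Reduction.reduction`) with the IR input in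
  Cauchy–Schwarz currency and the UV input with `Rot345`; `AxisSymmetry`/`UCLOfGap` are no longer hypotheses (used inside
  the sibling theorems / retired with `TorusOSGap`), and the conclusion is STRENGTHENED by the continuum gap clause
  `T.HasMassGap Δ₁` of the same canonical witness (Literature `IsYangMillsFor.hasMassGap_of_hasCSClustering`) — the
  transfer half of crux (B) for that witness comes for free in this currency;
* `continuumLimitWithGap_of_inputsCS`, `continuumLimitOnTrajectory_of_inputsCS` — from exactly four named statements
  (`ChartExists` PROMOTED, `VolumeClause` QUARANTINED misstatement, `IRPhysicsCS`, `UVPhysics345`) the strengthened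
  statement, and the crux BY NAME (`continuumLimitOnTrajectory_of_withGap`).
Nothing here is an input or a named fact: the hypotheses are explicit antecedents. Refs: `…Reduction`; `…DefsE`;
`Cruxes/ContinuumLegGivenGap/NOTES.md` (cycles 4–5 of that lead); Luscher1977; OsterwalderSeiler1978 §§2–4.
-/

set_option autoImplicit false

open scoped SchwartzMap
open MeasureTheory Filter Topology
open Literature.MathematicalPhysics.QuantumFieldTheory Literature.MathematicalPhysics.QuantumLattice
open Literature.MathematicalPhysics.AQFT Literature.Probability.LatticeModels
open Summit.QuantumFields.YangMills.Theses.ParabolicTrajectory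
open Summit.QuantumFields.YangMills.Theorems.ContinuumLegGivenGap
  (stub_uclOfCscl stub_asympCS stub_smallRotation stub_bddSlabDensity stub_rotOfPythagorean stub_rotNiven stub_rotHyper)

noncomputable section

namespace Summit.QuantumFields.YangMills.Cruxes.ContinuumLimitOnTrajectory.TwoOrbitSynchronisation

namespace Reduction

/-- **The reduction, v3.5 (Cauchy–Schwarz currency, discrete rotation restoration, gap of the witness).** The nine
statements imply `ContinuumLimitWithGap` (kernel-checked; wiring as in `Reduction.reduction` except: `IRPhysicsCS` supplies
`QualFiniteSize` and `HasCSClustering r (canon r sch) Δ₁`; `UVPhysics345` supplies `UUVB`/`Rot345`/`ND2`/`ND3`, `AsympRot`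
follows by `stub_rotOfPythagorean`, `UVB` by `uvb_of_uuvb`; `UCL` by `stub_uclOfCscl`; the slab reflection positivity by
`torusSlabRP_of_tendsto`; and the gap clause of the witness by `IsYangMillsFor.hasMassGap_of_hasCSClustering`). -/
theorem reductionCS :
    TwoOrbitSync → ChartExists → Anatomy → VolumeClause → IRPhysicsCS → UVPhysics345 → ARPOfRP → TranslOfUUVB →
      OneFieldOSLegs' → ContinuumLimitWithGap := by
  intro hsync hchart hanat hvol hir huv harp htransl hlegs G _ _ _ _ hG
  letI : MeasurableSpace G := borel G
  haveI : BorelSpace G := ⟨rfl⟩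
  intro r
  obtain ⟨M₀, hM₀⟩ := hchart G hG r
  refine ⟨M₀, fun M hM h2M => ?_⟩
  obtain ⟨𝒞⟩ := hM₀ M hM h2M
  /- constants, independent of the tuning -/
  set κ₀ : ℝ := (1 - 𝒞.θ') / 2 with hκ₀_def
  have h1θ : 0 < 1 - 𝒞.θ' := by linarith [𝒞.θ'_lt_one]
  have hκ₀pos : 0 < κ₀ := by rw [hκ₀_def]; positivity
  have hdom : 𝒞.θ' * (1 + κ₀) < 1 := by
    rw [hκ₀_def]; nlinarith [𝒞.θ'_nonneg, 𝒞.θ'_lt_one, h1θ]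
  obtain ⟨ε₀, K, θ₁, hε₀, hK, hθ₁0, hθ₁1, hS⟩ := hsync 𝒞.θ' κ₀ 𝒞.θ'_nonneg hκ₀pos.le hdom
  -- the sub-window γ'
  have hev : ∀ᶠ x in 𝓝[>] (0 : ℝ), (0 < x ∧ x ≤ 𝒞.γ) ∧ 𝒞.Cκ * x ^ 2 ≤ κ₀ ∧
      𝒞.C₁ * (𝒞.C₃ * x ^ 3) ≤ ε₀ ∧ 8 * 𝒞.b * x ^ 2 ≤ 1 ∧ K * 𝒞.C₁ * (𝒞.ℓ₀ * x) ≤ 1 / 2 := by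
    have hIoc : ∀ᶠ x in 𝓝[>] (0 : ℝ), 0 < x ∧ x ≤ 𝒞.γ := by
      filter_upwards [Ioo_mem_nhdsGT 𝒞.γ_pos] with x hx using ⟨hx.1, hx.2.le⟩
    have hcts : ∀ (c : ℝ) {p : ℕ}, 0 < p → Tendsto (fun x : ℝ => c * x ^ p) (𝓝[>] 0) (𝓝 0) := by
      intro c p hp
      have hc : Continuous (fun x : ℝ => c * x ^ p) := by fun_prop
      have h := (hc.tendsto (0 : ℝ)).mono_left (nhdsWithin_le_nhds (s := Set.Ioi (0 : ℝ)))
      simpa [zero_pow hp.ne'] using h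
    have h1 : ∀ᶠ x in 𝓝[>] (0 : ℝ), 𝒞.Cκ * x ^ 2 ≤ κ₀ := (hcts 𝒞.Cκ two_pos).eventually_le_const hκ₀pos
    have h2 : ∀ᶠ x in 𝓝[>] (0 : ℝ), 𝒞.C₁ * (𝒞.C₃ * x ^ 3) ≤ ε₀ :=
      ((hcts (𝒞.C₁ * 𝒞.C₃) three_pos).eventually_le_const hε₀).mono fun x hx => by
        simpa only [mul_assoc] using hx
    have h3 : ∀ᶠ x in 𝓝[>] (0 : ℝ), 8 * 𝒞.b * x ^ 2 ≤ 1 :=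
      (hcts (8 * 𝒞.b) two_pos).eventually_le_const one_pos
    have h4 : ∀ᶠ x in 𝓝[>] (0 : ℝ), K * 𝒞.C₁ * (𝒞.ℓ₀ * x) ≤ 1 / 2 :=
      ((hcts (K * 𝒞.C₁ * 𝒞.ℓ₀) one_pos).eventually_le_const (u := 1 / 2) (by norm_num)).mono fun x hx => by
        simpa only [mul_assoc, pow_one] using hx
    exact hIoc.and (h1.and (h2.and (h3.and h4)))
  obtain ⟨γ', ⟨hγ'pos, hγ'le⟩, hκle, hprod, h8b, hsmall⟩ := hev.exists
  -- the synchronisation constants at (κ, c₁, c₃) = (Cκ γ'², C₁, C₃ γ'³)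
  have hSk := hS (𝒞.Cκ * γ' ^ 2) 𝒞.C₁ (𝒞.C₃ * γ' ^ 3) (by have := 𝒞.Cκ_nonneg; positivity) hκle
    𝒞.C₁_nonneg (by have := 𝒞.C₃_nonneg; positivity) hprod
  /- the tuning data -/
  refine ⟨1, one_pos, fun θ Δ sch n hθ _ hΔ hshape hβ htower htune hgap => ?_⟩
  have hgrowth : PolyVolumeGrowth sch := hvol G hG r M θ Δ sch n hθ hΔ hshape hβ htower htune hgap
  obtain ⟨hvol', Δ₁, hΔ₁, hCS⟩ := hir G hG r M θ Δ sch n hθ hΔ hshape hβ htower htune hgap hgrowth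
  -- Wilson couplings (uses β_k → ∞)
  classical
  let g : ℕ → ℝ := fun k => if h : 𝒞.B₀ ≤ sch.β k then (𝒞.betaOf_surj (sch.β k) h).choose else 𝒞.g₀
  have hgk : ∀ᶠ k in atTop, g k ∈ Set.Ioc (0 : ℝ) 𝒞.g₀ ∧ 𝒞.betaOf (g k) = sch.β k := by
    filter_upwards [hβ.eventually_ge_atTop 𝒞.B₀] with k hk
    simp only [g, dif_pos hk]
    exact (𝒞.betaOf_surj (sch.β k) hk).choose_spec
  have hgβ : Tendsto (fun k => 𝒞.betaOf (g k)) atTop atTop :=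
    hβ.congr' (hgk.mono fun k hk => hk.2.symm)
  have hn : Tendsto n atTop atTop :=
    Summit.QuantumFields.YangMills.Theorems.LatticeGapOnTrajectory.Negative.tendsto_n_of_shape sch hshape
  -- infinite-volume towers (VolumeIndependence (b) + corr_tendsto)
  have hclose : ∀ t : ℕ, 0 < t → ∀ ε : ℝ, 0 < ε → ∀ᶠ k in atTop,
      |((M : ℝ) ^ n k) ^ 8 *
          latticeConnectedCorr r.ρ (sch.β k) (sch.side k) r.curvature.F r.curvature.F (t * M ^ n k) -
        ((M : ℝ) ^ n k) ^ 8 * 𝒞.corrInf (g k) (t * M ^ n k)| ≤ ε := by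
    intro t ht ε hε
    filter_upwards [hvol'.2 t ht ε hε, hgk] with k hk hg'
    have hT := 𝒞.corr_tendsto (g k) hg'.1 (t * M ^ n k)
    rw [hg'.2] at hT
    rw [← mul_sub, abs_mul, abs_of_nonneg (by positivity)]
    refine le_of_tendsto ((tendsto_const_nhds.sub hT).abs.const_mul _) (eventually_atTop.2 ⟨sch.L k, ?_⟩)
    intro S hS'
    exact hk S hS'
  have htowerInf : ∀ t : ℕ, 0 < t → ∃ c : ℝ,
      Tendsto (fun k => ((M : ℝ) ^ n k) ^ 8 * 𝒞.corrInf (g k) (t * M ^ n k)) atTop (𝓝 c) := by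
    intro t ht
    obtain ⟨c, hc⟩ := htower t ht
    exact ⟨c, tendsto_of_forall_eventually_abs_sub_le hc fun ε hε =>
      (hclose t ht ε hε).mono fun k hk => by rwa [abs_sub_comm] at hk⟩
  have htune1 : Tendsto (fun k => ((M : ℝ) ^ n k) ^ 8 * 𝒞.corrInf (g k) (M ^ n k)) atTop (𝓝 θ) := by
    have h := hclose 1 one_pos
    simp only [one_mul] at h
    exact tendsto_of_forall_eventually_abs_sub_le htune fun ε hε =>
      (h ε hε).mono fun k hk => by rwa [abs_sub_comm] at hk
  /- anatomy (uses θ > 0) -/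
  obtain ⟨m, g_low, J, hglow, hJ, hA⟩ :=
    hanat G r M 𝒞 γ' hγ'pos hγ'le h8b θ g n hθ (hgk.mono fun k hk => hk.1) hgβ hn htune1
  /- the pin and its readout sequence -/
  obtain ⟨t, ht, c_r, hc_r, η, hη, hpin⟩ := 𝒞.pin m g_low γ' hglow hγ'pos hγ'le
  obtain ⟨ct, hct⟩ := htowerInf t ht
  have hRd : Tendsto (fun k => 𝒞.Rd m t (g k) (J k)) atTop (𝓝 ct) := by
    refine hct.congr' ?_
    filter_upwards [hA] with k hk
    rw [TwoOrbitChart.Rd, hk.1]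
  /- the terminal chart points form a Cauchy sequence -/
  set q : ℕ → ℝ × 𝒞.E := fun k => 𝒞.orb (g k) (J k) with hq_def
  have hcauchy : CauchySeq q := by
    rw [cauchySeq_iff_tendsto_dist_atTop_0, ← prod_atTop_atTop_eq]
    have hmin : Tendsto (fun p : ℕ × ℕ => min (J p.1) (J p.2)) (atTop ×ˢ atTop) atTop :=
      tendsto_atTop.2 fun b => ((tendsto_atTop.1 (hJ.comp tendsto_fst) b).and
        (tendsto_atTop.1 (hJ.comp tendsto_snd) b)).mono fun p hp => le_min hp.1 hp.2
    have hD : Tendsto (fun p : ℕ × ℕ => |𝒞.Rd m t (g p.1) (J p.1) - 𝒞.Rd m t (g p.2) (J p.2)|)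
        (atTop ×ˢ atTop) (𝓝 0) := by
      have := ((hRd.comp tendsto_fst).sub (hRd.comp tendsto_snd)).abs
      simpa using this
    have hηp : Tendsto (fun p : ℕ × ℕ => |η (min (J p.1) (J p.2))|) (atTop ×ˢ atTop) (𝓝 0) := by
      simpa using (hη.comp hmin).abs
    have hP : Tendsto (fun p : ℕ × ℕ => θ₁ ^ (min (J p.1) (J p.2) - 𝒞.j₀)) (atTop ×ˢ atTop) (𝓝 0) :=
      (tendsto_pow_atTop_nhds_zero_of_lt_one hθ₁0 hθ₁1).comp ((tendsto_sub_atTop_nat 𝒞.j₀).comp hmin)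
    have hbound : Tendsto (fun p : ℕ × ℕ =>
        (1 + K * 𝒞.C₁) * ((2 / c_r) * (|𝒞.Rd m t (g p.1) (J p.1) - 𝒞.Rd m t (g p.2) (J p.2)| +
            |η (min (J p.1) (J p.2))|) + 4 * 𝒞.ℓ₀ * γ' * K * 𝒞.ρ * θ₁ ^ (min (J p.1) (J p.2) - 𝒞.j₀)) +
          2 * K * 𝒞.ρ * θ₁ ^ (min (J p.1) (J p.2) - 𝒞.j₀)) (atTop ×ˢ atTop) (𝓝 0) := by
      have := ((((hD.add hηp).const_mul (2 / c_r)).add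
        (hP.const_mul (4 * 𝒞.ℓ₀ * γ' * K * 𝒞.ρ))).const_mul (1 + K * 𝒞.C₁)).add
        (hP.const_mul (2 * K * 𝒞.ρ))
      simpa using this
    refine squeeze_zero' (Eventually.of_forall fun p => dist_nonneg) ?_ hbound
    filter_upwards [(hA.and hgk).prod_mk (hA.and hgk)] with p hp
    obtain ⟨⟨hA1, hg1⟩, ⟨hA2, hg2⟩⟩ := hp
    exact Reduction.pair_bound 𝒞 hγ'pos hγ'le hK hθ₁0 hc_r hsmall hSk hpin hg1.1 hg2.1 hA1.2.1 hA2.2.1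
      hA1.2.2.1 hA2.2.2.1 hA1.2.2.2.1 hA2.2.2.2.1 hA1.2.2.2.2 hA2.2.2.2.2
  /- the limit point, inside the closed window region -/
  obtain ⟨qs, hqs⟩ := cauchySeq_tendsto_of_complete hcauchy
  have hqW : ∀ᶠ k in atTop, q k ∈ 𝒞.W := by
    filter_upwards [hA] with k hk
    refine Set.mem_prod.2 ⟨⟨(hk.2.2.1 (J k) le_rfl).1, (hk.2.2.1 (J k) le_rfl).2.trans hγ'le⟩, ?_⟩
    rw [Metric.mem_closedBall, dist_zero_right]
    exact hk.2.2.2.1 (J k) hk.2.1 le_rfl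
  have hqsW : qs ∈ 𝒞.W := 𝒞.isClosed_W.mem_of_tendsto hqs hqW
  /- full-sequence convergence on products -/
  have hconv : ConvProducts r sch := by
    intro p hp f hf
    refine ⟨𝒞.expectInf qs p fun i => (blockDilate M)^[m] (f i), ?_⟩
    have hcont := (𝒞.continuousOn_expect p m f hf).continuousWithinAt hqsW
    have hv : Tendsto (fun k => 𝒞.expectInf (q k) p fun i => (blockDilate M)^[m] (f i)) atTop
        (𝓝 (𝒞.expectInf qs p fun i => (blockDilate M)^[m] (f i))) :=
      hcont.tendsto.comp (tendsto_nhdsWithin_iff.2 ⟨hqs, hqW⟩)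
    refine tendsto_of_forall_eventually_abs_sub_le hv fun ε hε => ?_
    filter_upwards [hvol'.1 p f hf ε hε, hA, hgk] with k hk hAk hg'
    have e1 : (𝒞.expectInf (q k) p fun i => (blockDilate M)^[m] (f i)) =
        𝒞.expectInf (𝒞.orb (g k) 0) p fun i => (blockDilate M)^[n k] (f i) := by
      show 𝒞.expectInf (𝒞.orb (g k) (J k)) p _ = _
      rw [𝒞.expect_iterate hg'.1 (J k) p]
      congr 1
      funext i
      rw [← Function.iterate_add_apply, hAk.1]
    have hlim := 𝒞.expect_wilson (g k) hg'.1 p fun i => (blockDilate M)^[n k] (f i)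
    rw [hg'.2] at hlim
    rw [e1]
    exact abs_sub_le_of_uniform hlim hk
  /- UV inputs, the three lattice-kinematics stubs, and the OS legs -/
  obtain ⟨hUUVB, h345, hND2, hND3⟩ :=
    huv G hG r M θ Δ sch n hθ hΔ hshape hβ htower htune hgap hgrowth hconv
  -- rotation restoration from ONE Pythagorean rotation (sibling crux stmt-15828, landed p133709 + p133202 + p133520)
  have hRot : AsympRot r sch := stub_rotOfPythagorean G r sch stub_rotNiven stub_rotHyper hUUVB h345
  have hUVB : UVB r sch := uvb_of_uuvb r sch hUUVB
  have hARP : ARP r sch := harp G r sch (torusSlabRP_of_tendsto r sch hβ) hUUVB hUVB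
  have hE1 : AsympEuclid r sch := (asympEuclid_iff r sch).2 ⟨htransl G r sch hgrowth hUUVB, hRot⟩
  -- E4 from Cauchy–Schwarz clustering of the canonical scheme (sibling crux stmt-15828, landed p132690 + wave-6 glue)
  have hUCL : UCL r sch :=
    stub_uclOfCscl G r sch stub_asympCS stub_smallRotation stub_bddSlabDensity hβ hUUVB hgrowth hRot ⟨Δ₁, hΔ₁, hCS⟩
  obtain ⟨T, hYM, hNT, hNG⟩ := hlegs G r sch hconv hUVB hE1 hARP hUCL hND2 hND3
  exact ⟨canon r sch, rfl, rfl, rfl, T, hYM, hNT, hNG, Δ₁, hΔ₁, hYM.hasMassGap_of_hasCSClustering hCS⟩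

end Reduction

/-- **`ContinuumLimitWithGap` from four named statements** (the v3.5 reduction applied to the landed stubs `stub_sync`,
`stub_anatomy`, `stub_arp`, `stub_transl`, `stub_osPackaging`): the promoted chart, the quarantined volume clause, the IR
physics input in Cauchy–Schwarz currency and the UV physics input with discrete rotation restoration imply crux (A) together
with the continuum gap clause of the same witness. -/
theorem continuumLimitWithGap_of_inputsCS :
    ChartExists → VolumeClause → IRPhysicsCS → UVPhysics345 → ContinuumLimitWithGap :=
  fun hchart hvol hir huv =>
    Reduction.reductionCS stub_sync hchart stub_anatomy hvol hir huv stub_arp stub_transl stub_osPackaging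

/-- **The crux BY NAME from four named statements (v3.5).** -/
theorem continuumLimitOnTrajectory_of_inputsCS :
    ChartExists → VolumeClause → IRPhysicsCS → UVPhysics345 → ContinuumLimitOnTrajectory :=
  fun hchart hvol hir huv =>
    continuumLimitOnTrajectory_of_withGap (continuumLimitWithGap_of_inputsCS hchart hvol hir huv)

end Summit.QuantumFields.YangMills.Cruxes.ContinuumLimitOnTrajectory.TwoOrbitSynchronisation

end
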